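import Mathlib
import Summits.QuantumAdvantage.QuantumAdvantage.Theorems.WhiteBoxWalkWbwVerifiableLineNoSpeedupCycleSurgeryDefs

/-!
# Crux `WhiteBoxWalk.WbwVerifiableLineNoSpeedup` (stmt-QuantumAdvantage-2239), line
`cycle-surgery-adversary` — registered stub `stub_goodSetCard` (lead prover)

The parity count behind the min-degree bound of the cycle-surgery relation: for `S` in the
prefix-pinned long-cycle family (`4 ≤ m`, `1 ≤ T`, `T + 1 ≤ 2^(m-1)`), a cut `pre ≤ k < T` and a
target parity `b`, at least `2^(m-3)` partners at cut `k` have a sink of parity `b`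
(`mergeGood` + `splitGood`). Pure finite counting over `Fin (2^m)` and the source cycle; sorry-free. -/

noncomputable section

set_option linter.dupNamespace false

namespace Summit.QuantumAdvantage.QuantumAdvantage.Theorems.WbwVerifiableLineNoSpeedup.CycleSurgery

open Literature.Computability.Cryptography Literature.Computability.QuantumComplexity

/-! ## §7 The parity count behind the min degree (lead prover; registered stub `stub_goodSetCard`) -/

section GoodSet

variable {m T : ℕ}

/-- **Registered stub `stub_goodSetCard`.** For `S` in the family (`4 ≤ m`, `1 ≤ T`,
`T + 1 ≤ 2^(m-1)`), a cut `pre ≤ k < T` and a target parity `b`, at least `2^(m-3)` partners at cut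
`k` have a sink of parity `b`. Counting: the names of parity `b` number `2^(m-1)`; those OFF the source
cycle inject into `mergeGood` by `w ↦ S^{-(T-k)} w`; those ON the cycle at a position `p > T + hid`
inject into `splitGood` by `p ↦ p - (T - k)`; the remaining cycle positions `p ≤ T + hid` are at most
`⌊pre/2⌋ + 1` prefix positions of parity `b` (`x_p = p` for `p ≤ pre`) plus the `2 · hid` positions
`pre < p ≤ T + hid`; and `2^(m-1) - (⌊pre/2⌋ + 1) - 2 hid ≥ 2^(m-3)` because `hid ≤ 2^(m-4)` and
`pre = T - hid ≤ 2^(m-1) - 1 - hid`. -/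
theorem stub_goodSetCard :
    ∀ (m T : ℕ) (S : Equiv.Perm (Fin (2 ^ m))) (k : ℕ) (b : Bool), 4 ≤ m → 1 ≤ T →
      T + 1 ≤ 2 ^ (m - 1) → InFamily m T S → pre m T ≤ k → k < T →
        2 ^ (m - 3) ≤ (mergeGood m T S k b).card + (splitGood m T S k b).card := by
  intro m T S k b hm hT hTm hS hk hkT
  classical
  have hinj := hS.2.1
  have hL : T < srcPeriod S := lt_srcPeriod_of_injective hinj
  have hph : pre m T + hid m T = T := pre_add_hid m T
  have hhid1 : 1 ≤ hid m T := one_le_hid hT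
  have hhidX : hid m T ≤ 2 ^ (m - 4) := hid_le_pow m T
  -- powers of two: `m = m' + 4`, `X = 2^m'`
  obtain ⟨m', rfl⟩ : ∃ m', m = m' + 4 := ⟨m - 4, by omega⟩
  have e4 : m' + 4 - 4 = m' := by omega
  have e3 : m' + 4 - 3 = m' + 1 := by omega
  have e1 : m' + 4 - 1 = m' + 3 := by omega
  rw [e4] at hhidX
  rw [e1] at hTm
  rw [e3]
  set X : ℕ := 2 ^ m' with hX
  have hX1 : 1 ≤ X := Nat.one_le_two_pow
  have h2 : 2 ^ (m' + 1) = 2 * X := by rw [hX, pow_succ, mul_comm]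
  have h8 : 2 ^ (m' + 3) = 8 * X := by rw [hX, pow_add]; norm_num; ring
  have h16 : 2 ^ (m' + 4) = 16 * X := by rw [hX, pow_add]; norm_num; ring
  rw [h8] at hTm
  rw [h2]
  -- the parity class `b` as a residue `r`
  set r : ℕ := if b then 1 else 0 with hr
  have hpar : ∀ n : ℕ, (decide (n % 2 = 1) = b) ↔ n % 2 = r := by
    intro n
    rw [hr]
    cases b
    · simp only [decide_eq_false_iff_not, Bool.false_eq_true, if_false]
      omega
    · simp only [decide_eq_true_eq, if_true]
  -- names of parity `b`
  set Pb : Finset (Fin (2 ^ (m' + 4))) :=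
    Finset.univ.filter fun x => decide (x.val % 2 = 1) = b with hPb
  have hPb_card : 8 * X ≤ Pb.card := by
    let f : ℕ → Fin (2 ^ (m' + 4)) := fun t =>
      ⟨(2 * t + r) % 2 ^ (m' + 4), Nat.mod_lt _ (by positivity)⟩
    have hfval : ∀ t : ℕ, t < 8 * X → (f t).val = 2 * t + r := by
      intro t ht
      show (2 * t + r) % 2 ^ (m' + 4) = 2 * t + r
      rw [h16]
      have hr2 : r ≤ 1 := by rw [hr]; split_ifs <;> norm_num
      exact Nat.mod_eq_of_lt (by omega)
    have hsub : (Finset.range (8 * X)).image f ⊆ Pb := by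
      intro x hx
      obtain ⟨t, ht, rfl⟩ := Finset.mem_image.1 hx
      rw [Finset.mem_range] at ht
      rw [hPb, Finset.mem_filter]
      refine ⟨Finset.mem_univ _, (hpar _).2 ?_⟩
      rw [hfval t ht]
      have hr2 : r ≤ 1 := by rw [hr]; split_ifs <;> norm_num
      omega
    have hinjOn : Set.InjOn f (Finset.range (8 * X)) := by
      intro t₁ ht₁ t₂ ht₂ h
      rw [Finset.coe_range, Set.mem_Iio] at ht₁ ht₂
      have := congrArg Fin.val h
      rw [hfval t₁ ht₁, hfval t₂ ht₂] at this
      omega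
    calc 8 * X = (Finset.range (8 * X)).card := (Finset.card_range _).symm
      _ = ((Finset.range (8 * X)).image f).card := (Finset.card_image_of_injOn hinjOn).symm
      _ ≤ Pb.card := Finset.card_le_card hsub
  -- the source cycle as a finset
  set onCyc : Finset (Fin (2 ^ (m' + 4))) := (Finset.range (srcPeriod S)).image (pt S) with honCyc
  have hmem_onCyc : ∀ w, w ∈ onCyc ↔ ¬ OffCycle S w := by
    intro w
    constructor
    · rintro hw hoff
      obtain ⟨i, -, rfl⟩ := Finset.mem_image.1 hw
      exact hoff i rfl
    · intro h
      obtain ⟨i, hi, rfl⟩ := exists_lt_srcPeriod_of_not_offCycle h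
      exact Finset.mem_image.2 ⟨i, Finset.mem_range.2 hi, rfl⟩
  -- (1) parity-`b` names off the cycle inject into `mergeGood` by `w ↦ S^{-(T-k)} w`
  have h1 : (Pb \ onCyc).card ≤ (mergeGood (m' + 4) T S k b).card := by
    have hsub : (Pb \ onCyc).image ⇑((S ^ (T - k)).symm) ⊆ mergeGood (m' + 4) T S k b := by
      intro v hv
      obtain ⟨w, hw, rfl⟩ := Finset.mem_image.1 hv
      rw [Finset.mem_sdiff] at hw
      obtain ⟨hwP, hwC⟩ := hw
      have hoff : OffCycle S w := by
        by_contra h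
        exact hwC ((hmem_onCyc w).2 h)
      rw [mem_mergeGood]
      refine ⟨fun j hj => ?_, ?_⟩
      · apply hoff (j + (T - k))
        rw [pt_add, hj, Equiv.apply_symm_apply]
      · rw [Equiv.apply_symm_apply]
        rw [hPb, Finset.mem_filter] at hwP
        exact hwP.2
    calc (Pb \ onCyc).card = ((Pb \ onCyc).image ⇑((S ^ (T - k)).symm)).card :=
          (Finset.card_image_of_injective _ (Equiv.injective _)).symm
      _ ≤ _ := Finset.card_le_card hsub
  -- (2) far cycle positions of parity `b` inject into `splitGood` by `p ↦ p - (T - k)`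
  set Pset : Finset ℕ := (Finset.range (srcPeriod S)).filter fun p =>
    T + hid (m' + 4) T < p ∧ decide ((pt S p).val % 2 = 1) = b with hPset
  have h2' : Pset.card ≤ (splitGood (m' + 4) T S k b).card := by
    have hsub : Pset.image (fun p => p - (T - k)) ⊆ splitGood (m' + 4) T S k b := by
      intro q hq
      obtain ⟨p, hp, rfl⟩ := Finset.mem_image.1 hq
      rw [hPset, Finset.mem_filter, Finset.mem_range] at hp
      obtain ⟨hpL, hpT, hpb⟩ := hp
      rw [mem_splitGood]
      refine ⟨by omega, by omega, ?_⟩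
      rw [show p - (T - k) + (T - k) = p by omega]
      exact hpb
    have hinjOn : Set.InjOn (fun p => p - (T - k)) Pset := by
      intro p₁ hp₁ p₂ hp₂ h
      rw [hPset, Finset.coe_filter, Set.mem_setOf_eq] at hp₁ hp₂
      have h₁ : T - k ≤ p₁ := by omega
      have h₂ : T - k ≤ p₂ := by omega
      simp only at h
      omega
    calc Pset.card = (Pset.image fun p => p - (T - k)).card := (Finset.card_image_of_injOn hinjOn).symm
      _ ≤ _ := Finset.card_le_card hsub
  -- (3) parity-`b` names ON the cycle: prefix + hidden window + far positions
  have h3 : (Pb ∩ onCyc).card ≤ (pre (m' + 4) T / 2 + 1) + 2 * hid (m' + 4) T + Pset.card := by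
    set idxB : Finset ℕ := (Finset.range (srcPeriod S)).filter fun i =>
      decide ((pt S i).val % 2 = 1) = b with hidxB
    have hsub1 : Pb ∩ onCyc ⊆ idxB.image (pt S) := by
      intro w hw
      rw [Finset.mem_inter] at hw
      obtain ⟨hwP, hwC⟩ := hw
      obtain ⟨i, hi, rfl⟩ := Finset.mem_image.1 hwC
      rw [hPb, Finset.mem_filter] at hwP
      exact Finset.mem_image.2 ⟨i, by rw [hidxB, Finset.mem_filter]; exact ⟨hi, hwP.2⟩, rfl⟩
    set lowPar : Finset ℕ := (Finset.range (pre (m' + 4) T + 1)).filter fun i => i % 2 = r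
      with hlowPar
    set mid : Finset ℕ := Finset.Ioc (pre (m' + 4) T) (T + hid (m' + 4) T) with hmid
    have hsub2 : idxB ⊆ lowPar ∪ mid ∪ Pset := by
      intro i hi
      rw [hidxB, Finset.mem_filter, Finset.mem_range] at hi
      obtain ⟨hiL, hib⟩ := hi
      rw [Finset.mem_union, Finset.mem_union]
      rcases le_or_gt i (pre (m' + 4) T) with hip | hip
      · left; left
        rw [hlowPar, Finset.mem_filter, Finset.mem_range]
        refine ⟨by omega, ?_⟩
        rw [val_pt_of_le_pre hS i hip] at hib
        exact (hpar i).1 hib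
      · rcases le_or_gt i (T + hid (m' + 4) T) with hiT | hiT
        · left; right
          rw [hmid, Finset.mem_Ioc]
          exact ⟨hip, hiT⟩
        · right
          rw [hPset, Finset.mem_filter, Finset.mem_range]
          exact ⟨hiL, hiT, hib⟩
    have hlow : lowPar.card ≤ pre (m' + 4) T / 2 + 1 := by
      have hsub : lowPar ⊆ (Finset.range (pre (m' + 4) T / 2 + 1)).image fun t => 2 * t + r := by
        intro i hi
        rw [hlowPar, Finset.mem_filter, Finset.mem_range] at hi
        have hr2 : r ≤ 1 := by rw [hr]; split_ifs <;> norm_num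
        exact Finset.mem_image.2 ⟨i / 2, Finset.mem_range.2 (by omega), by omega⟩
      calc lowPar.card ≤ ((Finset.range (pre (m' + 4) T / 2 + 1)).image fun t => 2 * t + r).card :=
            Finset.card_le_card hsub
        _ ≤ (Finset.range (pre (m' + 4) T / 2 + 1)).card := Finset.card_image_le
        _ = pre (m' + 4) T / 2 + 1 := Finset.card_range _
    have hmidc : mid.card = 2 * hid (m' + 4) T := by
      rw [hmid, Nat.card_Ioc]
      omega
    calc (Pb ∩ onCyc).card ≤ (idxB.image (pt S)).card := Finset.card_le_card hsub1
      _ ≤ idxB.card := Finset.card_image_le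
      _ ≤ (lowPar ∪ mid ∪ Pset).card := Finset.card_le_card hsub2
      _ ≤ (lowPar ∪ mid).card + Pset.card := Finset.card_union_le _ _
      _ ≤ lowPar.card + mid.card + Pset.card := by
          gcongr
          exact Finset.card_union_le _ _
      _ ≤ _ := by rw [hmidc]; omega
  -- assemble
  have hsplit : (Pb \ onCyc).card + (Pb ∩ onCyc).card = Pb.card :=
    Finset.card_sdiff_add_card_inter Pb onCyc
  omega

end GoodSet

end Summit.QuantumAdvantage.QuantumAdvantage.Theorems.WbwVerifiableLineNoSpeedup.CycleSurgery

end
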